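import Summits.HodgeConjecture.HodgeConjecture.Theorems.Ring2AbelianAllAndreWeightPairing
import Summits.HodgeConjecture.HodgeConjecture.Theorems.Ring2AbelianAllAndreSquarePencilEndomorphisms
import Literature.AlgebraicGeometry.Motives.AbelianVarietyProduct
import Mathlib.LinearAlgebra.Lagrange
import HarnessLib

/-!
# Ring 2 · sub-cell AbelianAll (ALL ABELIAN VARIETIES), André axis, part XXXVII-c — THE TOP LERAY PIECE OF THE FIBRE SQUARE:
# the square `𝒳 ×_S 𝒳` carries the fibrewise multiplication `θ₁ θ₂` (charted by `[N]` on `A × A`), so the weight package applies to it;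
# a TOP-WEIGHT class of the square is DETERMINED BY ONE FIBRE; top-weight classes split into `θ₁`-BI-WEIGHTS (Lagrange in `θ₁^*`);
# (each bi-weight component a polynomial in `θ₁^*`, hence algebraic when the class is)

HONEST FRAMING (page 1, verbatim): **research route, not a corollary; conditional on HC_CM plus one named
minimal statement.** Cell line: research route conditional on HC_CM; not a corollary; Q11.4-sentence-2
already refuted in dim ≥ 3. Nothing in this file proves a case of the Hodge conjecture for an abelian variety; `HC_CM` does not occur in
this file; item `Theses.RankFourFaces.CMToAbelian` (stmt-16267) OPEN and not closed here. Seat `pub-hodge-ring2-ab-andre-2`, gen 29;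
brief (iii). Part XXXVII derives the middle relative Lefschetz block (ρ) of ring2-b05's `B⋆(𝒳)` assembly from the fibre square by weights.

## What is proved (theorems only; no definition, no named fact, no sorry; `HC_CM` absent)

Setting: `f : 𝒳 ⟶ S` a compact pencil of abelian `d`-folds, `ν` an `S`-endomorphism charted by `N · 𝟙_A` on every fibre (`N ≥ 2`),
`θ₁, θ₂` the partial multiplications of the square `𝒴 = 𝒳 ×_S 𝒳 ⟶ S` (part XXXVII-b: `θ₁ ≫ a = a ≫ ν`, `θ₁ ≫ b = b`, `θ₂ ≫ a = a`,
`θ₂ ≫ b = b ≫ ν`), a point `t`.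

* §1 `nsmul_id_prod_hom` — multiplication by `N` on a product abelian variety is `[N] × [N]` (preadditivity).
* §2 **`exists_square_chart`** — THE SQUARE CARRIES A FIBREWISE MULTIPLICATION: `θ₁ θ₂` restricts on EVERY fibre `Y_s ≅ X_s × X_s ≅ A × A`
  to an endomorphism charted by `N · 𝟙_{A × A}`. Hence the whole weight package of parts XXV–XXXVII-a applies to the compact pencil
  `𝒴 ⟶ S` of abelian `2d`-folds (part XXXIII-b `isCompactAbelianPencil_square`) with the datum `θ₁ θ₂`.
* §3 (any compact pencil with a fibrewise multiplication) **`eq_zero_of_topWeight_of_map_fiberι_eq_zero` — A TOP-WEIGHT CLASS IS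
  DETERMINED BY ONE FIBRE**: `ν^* D = N^{k+2} D` and `j_t^* D = 0` imply `D = 0` (part XXXVI-b: `e₀ D = D`, `e₀|_{ker j_t^*} = 0`).
* §4 (linear algebra) `aeval_apply_of_comm` (transport of `p(T)` along an intertwiner); **`aeval_prod_squareEndo_fst_eq_zero_of_topWeight`** —
  on a top-weight class `D ∈ Hᵐ(𝒴)` (`(θ₁θ₂)^* D = Nᵐ D`), `∏_{u=0}^{m} (θ₁^* − Nᵘ) D = 0` (restrict to `Y_t`, where `θ₁` is `ν_t × 1` with
  Künneth eigenvalues `Nᵘ`, part XXXVII-b; the polynomial in `θ₁^*` of `D` is again of top weight, so §3 applies);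
  **`exists_biweight_decomposition`** — hence `D = Σ_{u ≤ m} D_u` with `θ₁^* D_u = Nᵘ D_u`, `(θ₁θ₂)^* D_u = Nᵐ D_u` (so `θ₂^* D_u = N^{m-u} D_u`),
  each `D_u` a polynomial in `θ₁^*` applied to `D` (Lagrange interpolation, Mathlib `Lagrange.basis`), hence ALGEBRAIC when `D` is;
* `aeval_map_mem_algebraicClasses` — polynomials in `θ^*` preserve algebraic classes (pull-backs are algebraic correspondences).
The degrees `θ_{1*} 1 = θ_{2*} 1 = N^{2d} · 1` and the selection rules of relative correspondences follow in part XXXVII-d.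

## Honest status

Per-pencil statements for a GIVEN fibrewise multiplication (θ∀ displayed); no node; nothing minimal; N104 untouched. Consumers: parts
XXXVII-d…f (selection rules of relative correspondences; the middle block).

References: DeningerMurre1991 (Thm. 3.1); Kunnemann1993 (§2, Thm. 3.1); Kleiman1968AlgebraicCycles (§1.3 p. 374); MumfordAV1970 (§19);
HatcherAT2002 (§3.2 Thm. 3.15, §3.3 Prop. 3.38); Fulton1998 (Thm. 6.2 (a)); FultonYoungTableaux1997 (App. B §B.1 (5)–(7)).
-/

noncomputable section

set_option linter.dupNamespace false

namespace Summit.HodgeConjecture.HodgeConjecture.Ring2.AbelianAll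

open CategoryTheory CategoryTheory.Limits AlgebraicGeometry MonoidalCategory CartesianMonoidalCategory
open Literature.AlgebraicGeometry Literature.AlgebraicGeometry.Motives
open Literature.AlgebraicGeometry.HodgeTheory
open Literature.AlgebraicTopology.SingularHomology (singularCohomology cupProduct cupProduct_map cupProduct_one cupPairing cupPairing_apply
  cupPairing_flip cupProduct_gradedComm_holds singularCohomologyZeroEquiv singularCohomologyZeroEquiv_one)
open Summit.HodgeConjecture.HodgeConjecture.Theorems (deg_fiberGysin_aux)

/-! ## §1 Multiplication by `N` on a product abelian variety -/

/-- **`N · 𝟙_{A × B} = [N]_A × [N]_B`** on the underlying scheme (composition of homomorphisms of abelian varieties is biadditive, and a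
morphism to a product is determined by its projections). [cite: MumfordAV1970, §19] -/
theorem nsmul_id_prod_hom (A B : AbelianVariety ℂ) (N : ℕ) :
    (N • 𝟙 (A.prod B)).hom.hom.hom = ((N • 𝟙 A).hom.hom.hom ⊗ₘ (N • 𝟙 B).hom.hom.hom : A.X ⊗ B.X ⟶ A.X ⊗ B.X) := by
  have h₁ : (N • 𝟙 (A.prod B)) ≫ AbelianVariety.fst A B = AbelianVariety.fst A B ≫ (N • 𝟙 A) := by
    rw [Preadditive.nsmul_comp, Category.id_comp, Preadditive.comp_nsmul, Category.comp_id]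
  have h₂ : (N • 𝟙 (A.prod B)) ≫ AbelianVariety.snd A B = AbelianVariety.snd A B ≫ (N • 𝟙 B) := by
    rw [Preadditive.nsmul_comp, Category.id_comp, Preadditive.comp_nsmul, Category.comp_id]
  have h₁' : ((N • 𝟙 (A.prod B)).hom.hom.hom : A.X ⊗ B.X ⟶ A.X ⊗ B.X) ≫ fst A.X B.X =
      fst A.X B.X ≫ (N • 𝟙 A).hom.hom.hom := congrArg (fun φ => φ.hom.hom.hom) h₁
  have h₂' : ((N • 𝟙 (A.prod B)).hom.hom.hom : A.X ⊗ B.X ⟶ A.X ⊗ B.X) ≫ snd A.X B.X =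
      snd A.X B.X ≫ (N • 𝟙 B).hom.hom.hom := congrArg (fun φ => φ.hom.hom.hom) h₂
  exact CartesianMonoidalCategory.hom_ext ((N • 𝟙 (A.prod B)).hom.hom.hom : A.X ⊗ B.X ⟶ A.X ⊗ B.X) _
    (h₁'.trans (tensorHom_fst _ _).symm) (h₂'.trans (tensorHom_snd _ _).symm)

variable {𝒳 S : SchemeOver ℂ} {d : ℕ} {f : 𝒳 ⟶ S}

/-- `𝒴` — the fibre square `𝒳 ×_S 𝒳` (display notation for the tree's `familyPullback f f`). -/
local notation3 (prettyPrint := false) "𝒴[" f "]" => familyPullback f f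
/-- `𝐚` — the first projection `𝒳 ×_S 𝒳 ⟶ 𝒳`. -/
local notation3 (prettyPrint := false) "𝐚[" f "]" => familyPullback.fst f f
/-- `𝐛` — the second projection `𝒳 ×_S 𝒳 ⟶ 𝒳` (the pencil structure of the square is `𝐛 ≫ f`). -/
local notation3 (prettyPrint := false) "𝐛[" f "]" => familyPullback.snd f f

/-! ## §2 The square carries a fibrewise multiplication: `θ₁ θ₂` is charted by `[N]` on `A × A` -/

/-- **THE FIBREWISE MULTIPLICATION OF THE SQUARE.** For `ν ≫ f = f` charted by `N · 𝟙_A` on every fibre and the partial multiplications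
`θ₁ = ν ×_S 1`, `θ₂ = 1 ×_S ν` of `𝒴 = 𝒳 ×_S 𝒳`: at every point `s` the composite `θ₁ θ₂` restricts on `Y_s` to an endomorphism charted by
`N · 𝟙_{A × A}` under `A × A ≅ X_s × X_s ≅ Y_s` (part XXXIII-b's iso; part XXXVII-b's charts `ν_s × 1`, `1 × ν_s`; §1). This is EXACTLY the
hypothesis `hθ` of the weight package (parts XXV–XXXVII-a) for the compact pencil `𝒴 ⟶ S` of abelian `2d`-folds.
[cite: MumfordAV1970, §19] [cite: Hartshorne1977, II §3 (base extension)] -/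
theorem exists_square_chart (ν : 𝒳 ⟶ 𝒳) (hν : ν ≫ f = f) (N : ℕ)
    (hθ : ∀ s : ComplexPoints S, ∃ (νs : fiberOver f s ⟶ fiberOver f s) (A : AbelianVariety ℂ) (e : A.X ≅ fiberOver f s),
      νs ≫ fiberι f s = fiberι f s ≫ ν ∧ e.hom ≫ νs = (N • 𝟙 A).hom.hom.hom ≫ e.hom)
    {θ₁ θ₂ : 𝒴[f] ⟶ 𝒴[f]} (h1a : θ₁ ≫ 𝐚[f] = 𝐚[f] ≫ ν) (h1b : θ₁ ≫ 𝐛[f] = 𝐛[f])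
    (h2a : θ₂ ≫ 𝐚[f] = 𝐚[f]) (h2b : θ₂ ≫ 𝐛[f] = 𝐛[f] ≫ ν) [IsSeparated S.hom] (s : ComplexPoints S) :
    ∃ (νs : fiberOver (𝐛[f] ≫ f) s ⟶ fiberOver (𝐛[f] ≫ f) s) (B : AbelianVariety ℂ) (eB : B.X ≅ fiberOver (𝐛[f] ≫ f) s),
      νs ≫ fiberι (𝐛[f] ≫ f) s = fiberι (𝐛[f] ≫ f) s ≫ (θ₁ ≫ θ₂) ∧ eB.hom ≫ νs = (N • 𝟙 B).hom.hom.hom ≫ eB.hom := by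
  obtain ⟨νsX, A, e, hνsX, he⟩ := hθ s
  obtain ⟨E, hEa, hEb⟩ := exists_fiberOver_familyPullback_iso f f s
  have hθ₁g : θ₁ ≫ (𝐛[f] ≫ f) = 𝐛[f] ≫ f := by rw [← Category.assoc, h1b]
  have hθ₂g : θ₂ ≫ (𝐛[f] ≫ f) = 𝐛[f] ≫ f := squareEndo_comp_eq hν h2b
  obtain ⟨θ1s, hθ1s⟩ := exists_fiberEndo_restrict θ₁ hθ₁g s
  obtain ⟨θ2s, hθ2s⟩ := exists_fiberEndo_restrict θ₂ hθ₂g s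
  have c1 := squareEndo_fst_chart s ν h1a h1b E hEa hEb νsX hνsX θ1s hθ1s
  have c2 := squareEndo_snd_chart s ν h2a h2b E hEa hEb νsX hνsX θ2s hθ2s
  refine ⟨θ1s ≫ θ2s, A.prod A, tensorIso e e ≪≫ E, ?_, ?_⟩
  · rw [Category.assoc, hθ2s, ← Category.assoc, hθ1s, Category.assoc]
  · have hN : ((N • 𝟙 (A.prod A)).hom.hom.hom : A.X ⊗ A.X ⟶ A.X ⊗ A.X) ≫ (tensorIso e e ≪≫ E).hom =
        ((N • 𝟙 A).hom.hom.hom ⊗ₘ (N • 𝟙 A).hom.hom.hom) ≫ (e.hom ⊗ₘ e.hom) ≫ E.hom := by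
      rw [nsmul_id_prod_hom, Iso.trans_hom, tensorIso_hom]; rfl
    calc (tensorIso e e ≪≫ E).hom ≫ θ1s ≫ θ2s = (e.hom ⊗ₘ e.hom) ≫ (E.hom ≫ θ1s) ≫ θ2s := by
          simp only [Iso.trans_hom, tensorIso_hom, Category.assoc]
      _ = (e.hom ⊗ₘ e.hom) ≫ ((νsX ▷ fiberOver f s) ≫ (fiberOver f s ◁ νsX)) ≫ E.hom := by
          rw [c1, Category.assoc, c2]; simp only [Category.assoc]
      _ = ((e.hom ≫ νsX) ⊗ₘ (e.hom ≫ νsX)) ≫ E.hom := by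
          rw [← MonoidalCategory.tensorHom_def, ← Category.assoc, MonoidalCategory.tensorHom_comp_tensorHom]
      _ = (((N • 𝟙 A).hom.hom.hom ≫ e.hom) ⊗ₘ ((N • 𝟙 A).hom.hom.hom ≫ e.hom)) ≫ E.hom := by rw [he]
      _ = ((N • 𝟙 A).hom.hom.hom ⊗ₘ (N • 𝟙 A).hom.hom.hom) ≫ (e.hom ⊗ₘ e.hom) ≫ E.hom := by
          rw [← MonoidalCategory.tensorHom_comp_tensorHom, Category.assoc]
      _ = (N • 𝟙 (A.prod A)).hom.hom.hom ≫ (tensorIso e e ≪≫ E).hom := hN.symm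

/-- The composite `θ₁ θ₂` is an `S`-endomorphism of the square pencil `𝐛 ≫ f`. [folklore] -/
theorem squareEndo_comp_comp_eq {ν : 𝒳 ⟶ 𝒳} (hν : ν ≫ f = f) {θ₁ θ₂ : 𝒴[f] ⟶ 𝒴[f]} (h1b : θ₁ ≫ 𝐛[f] = 𝐛[f])
    (h2b : θ₂ ≫ 𝐛[f] = 𝐛[f] ≫ ν) : (θ₁ ≫ θ₂) ≫ (𝐛[f] ≫ f) = 𝐛[f] ≫ f := by
  rw [Category.assoc, squareEndo_comp_eq hν h2b, ← Category.assoc, h1b]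

/-! ## §3 A top-weight class is determined by one fibre (any compact pencil with a fibrewise multiplication) -/

section TopWeight

variable {𝒵 T : SchemeOver ℂ} {n : ℕ} {g : 𝒵 ⟶ T}

/-- **A TOP-WEIGHT CLASS IS DETERMINED BY ONE FIBRE.** For a compact pencil `g : 𝒵 ⟶ T` of abelian `n`-folds with an `S`-endomorphism
`ν` charted by `N · 𝟙_A` on every fibre (`N ≥ 2`), a point `t` and `D ∈ H^{k+2}(𝒵(ℂ); ℂ)` (`k ≤ 2n`) of TOP weight `ν^* D = N^{k+2} D`:
`j_t^* D = 0 ⟹ D = 0` (part XXXVI-b's top idempotent: `e₀ D = D` and `e₀` kills `ker j_t^*` — in print `E_∞^{0,k+2} = H⁰(T, R^{k+2} g_*) ↪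
H^{k+2}(Z_t)`). [cite: DeningerMurre1991, Thm. 3.1] [cite: VoisinHodgeII2003, §4.2.3 Thm. 4.15] -/
theorem eq_zero_of_topWeight_of_map_fiberι_eq_zero (hg : IsCompactAbelianPencil g n) (t : ComplexPoints T) (ν : 𝒵 ⟶ 𝒵)
    (hν : ν ≫ g = g) {N : ℕ} (hN : 2 ≤ N)
    (hθ : ∀ s : ComplexPoints T, ∃ (νs : fiberOver g s ⟶ fiberOver g s) (A : AbelianVariety ℂ) (e : A.X ≅ fiberOver g s),
      νs ≫ fiberι g s = fiberι g s ≫ ν ∧ e.hom ≫ νs = (N • 𝟙 A).hom.hom.hom ≫ e.hom)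
    {k : ℕ} (hk : k ≤ 2 * n) {D : complexBetti 𝒵 (k + 2)} (htop : complexBetti.map ν (k + 2) D = ((N : ℂ) ^ (k + 2)) • D)
    (hJ : complexBetti.map (fiberι g t) (k + 2) D = 0) : D = 0 := by
  obtain ⟨e₀, e₁, e₂, -, -, -, -, -, -, -, hκ, -, hfix⟩ := exists_leraySplitting hg t ν hν hN hθ hk
  rw [← (hfix D).1.2 htop]
  exact hκ D hJ

end TopWeight

/-! ## §4 Bi-weights on the top piece of the square -/

section Transport

variable {K V W : Type*} [CommRing K] [AddCommGroup V] [Module K V] [AddCommGroup W] [Module K W]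

/-- **Transport of `p(T)` along an intertwiner**: `S ∘ T = T' ∘ S ⟹ S (p(T) v) = p(T') (S v)`. [folklore] -/
theorem aeval_apply_of_comm (S : V →ₗ[K] W) (T : Module.End K V) (T' : Module.End K W) (h : S ∘ₗ T = T' ∘ₗ S)
    (p : Polynomial K) (v : V) : S (Polynomial.aeval T p v) = Polynomial.aeval T' p (S v) := by
  induction p using Polynomial.induction_on' generalizing v with
  | add p q hp hq => rw [map_add, map_add, LinearMap.add_apply, LinearMap.add_apply, map_add, hp, hq]
  | monomial m a =>
    rw [Polynomial.aeval_monomial, Polynomial.aeval_monomial, Module.End.mul_apply, Module.End.mul_apply,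
      Module.algebraMap_end_apply, Module.algebraMap_end_apply, map_smul]
    congr 1
    induction m generalizing v with
    | zero => rw [pow_zero, pow_zero, Module.End.one_apply, Module.End.one_apply]
    | succ m ih =>
      rw [pow_succ, pow_succ, Module.End.mul_apply, Module.End.mul_apply, ih,
        show S (T v) = T' (S v) from LinearMap.congr_fun h v]

end Transport

section Algebraic

variable {Y : SchemeOver ℂ} {m : ℕ}

/-- **Polynomials in a pull-back preserve algebraic classes**: for `θ : Y ⟶ Y` (`Y` smooth projective) and `w ∈ Nᵉ H^{2e}(Y)`,
`P(θ^*) w ∈ Nᵉ H^{2e}(Y)` (pull-backs are algebraic correspondences, the tree's `isAlgebraicCorrespondence_map`, and algebraic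
correspondences preserve algebraic classes, part V). [cite: VoisinHodgeII2003, §9.2.4 Prop. 9.21] [cite: Fulton1998, §16.1] -/
theorem aeval_map_mem_algebraicClasses (hY : IsSmoothProjective m Y) (θ : Y ⟶ Y) (e : ℕ) (P : Polynomial ℂ)
    {w : complexBetti Y (2 * e)} (hw : w ∈ algebraicClasses Y e) :
    Polynomial.aeval (complexBetti.map θ (2 * e)).hom P w ∈ algebraicClasses Y e := by
  induction P using Polynomial.induction_on' generalizing w with
  | add p q hp hq => rw [map_add, LinearMap.add_apply]; exact Submodule.add_mem _ (hp hw) (hq hw)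
  | monomial n a =>
    rw [Polynomial.aeval_monomial, Module.End.mul_apply, Module.algebraMap_end_apply]
    refine Submodule.smul_mem _ _ ?_
    induction n generalizing w with
    | zero => exact hw
    | succ n ih =>
      rw [pow_succ, Module.End.mul_apply]
      refine ih ?_
      by_cases he : 2 * e ≤ 2 * m
      · exact map_mem_algebraicClasses_of_isAlgebraicCorrespondence hY hY (isAlgebraicCorrespondence_map hY hY θ he) hw
      · haveI := subsingleton_complexBetti hY (show 2 * m < 2 * e by omega)
        rw [Subsingleton.elim ((complexBetti.map θ (2 * e)).hom w) 0]
        exact Submodule.zero_mem _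

end Algebraic

section Biweights

variable (hf : IsCompactAbelianPencil f d)

/-- `𝐉[s, m]` — `J_s^* : Hᵐ(𝒴(ℂ); ℂ) → Hᵐ(Y_s(ℂ); ℂ)`, restriction to the fibre of the SQUARE over `s` (display notation). -/
local notation3 (prettyPrint := false) "𝐉[" s ", " m "]" => complexBetti.map (fiberι (familyPullback.snd f f ≫ f) s) m

include hf in
/-- **`∏_{u ≤ m} (θ₁^* − Nᵘ)` KILLS THE TOP-WEIGHT CLASSES OF `Hᵐ(𝒴)`.** For `D ∈ H^{k+2}(𝒴)` with `(θ₁θ₂)^* D = N^{k+2} D` (`k ≤ 4d`):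
`(∏_{u=0}^{k+2} (θ₁^* − Nᵘ)) D = 0`. Proof: the polynomial `P(θ₁^*) D` is again of top weight (`θ₁` and `θ₁θ₂` commute), and it dies on
`Y_t`: there `θ₁` is `ν_t × 1` (part XXXVII-b `squareEndo_fst_chart`), whose Künneth eigenvalues on `H^{k+2}(X_t × X_t)` are the `Nᵘ`,
`u ≤ k + 2` (`aeval_prod_whiskerRight_eq_zero`); so §3 applies. [cite: Kunnemann1993, §2] [cite: HatcherAT2002, §3.2 Thm. 3.15]
[cite: DeningerMurre1991, Thm. 3.1] -/
theorem aeval_prod_squareEndo_fst_eq_zero_of_topWeight (t : ComplexPoints S) (ν : 𝒳 ⟶ 𝒳) (hν : ν ≫ f = f) {N : ℕ} (hN : 2 ≤ N)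
    (hθ : ∀ s : ComplexPoints S, ∃ (νs : fiberOver f s ⟶ fiberOver f s) (A : AbelianVariety ℂ) (e : A.X ≅ fiberOver f s),
      νs ≫ fiberι f s = fiberι f s ≫ ν ∧ e.hom ≫ νs = (N • 𝟙 A).hom.hom.hom ≫ e.hom)
    {θ₁ θ₂ : 𝒴[f] ⟶ 𝒴[f]} (h1a : θ₁ ≫ 𝐚[f] = 𝐚[f] ≫ ν) (h1b : θ₁ ≫ 𝐛[f] = 𝐛[f])
    (h2a : θ₂ ≫ 𝐚[f] = 𝐚[f]) (h2b : θ₂ ≫ 𝐛[f] = 𝐛[f] ≫ ν)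
    {k : ℕ} (hk : k ≤ 2 * (d + d)) {D : complexBetti 𝒴[f] (k + 2)}
    (htop : complexBetti.map (θ₁ ≫ θ₂) (k + 2) D = ((N : ℂ) ^ (k + 2)) • D) :
    Polynomial.aeval (complexBetti.map θ₁ (k + 2)).hom
      (∏ u ∈ Finset.range (k + 2 + 1), (Polynomial.X - Polynomial.C ((N : ℂ) ^ u))) D = 0 := by
  haveI : IsSeparated S.hom := hf.isSmoothProjective_base.isProjectiveOver.isProper.toIsSeparated
  have hg := isCompactAbelianPencil_square hf rfl
  have hνg := squareEndo_comp_comp_eq hν h1b h2b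
  have hchart := exists_square_chart ν hν N hθ h1a h1b h2a h2b
  set P : Polynomial ℂ := ∏ u ∈ Finset.range (k + 2 + 1), (Polynomial.X - Polynomial.C ((N : ℂ) ^ u)) with hP
  set T₁ : Module.End ℂ (complexBetti 𝒴[f] (k + 2)) := (complexBetti.map θ₁ (k + 2)).hom with hT₁
  -- `P(θ₁^*) D` is of top weight: `θ₁` commutes with `θ₁ θ₂`
  have hcomm : (complexBetti.map (θ₁ ≫ θ₂) (k + 2)).hom ∘ₗ T₁ = T₁ ∘ₗ (complexBetti.map (θ₁ ≫ θ₂) (k + 2)).hom := by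
    apply LinearMap.ext; intro w
    change complexBetti.map (θ₁ ≫ θ₂) (k + 2) (complexBetti.map θ₁ (k + 2) w) =
      complexBetti.map θ₁ (k + 2) (complexBetti.map (θ₁ ≫ θ₂) (k + 2) w)
    rw [← complexBetti.map_comp_apply', ← complexBetti.map_comp_apply', Category.assoc,
      ← squareEndo_comm ν h1a h1b h2a h2b]
  have htop' : complexBetti.map (θ₁ ≫ θ₂) (k + 2) (Polynomial.aeval T₁ P D) = ((N : ℂ) ^ (k + 2)) • Polynomial.aeval T₁ P D := by
    change (complexBetti.map (θ₁ ≫ θ₂) (k + 2)).hom (Polynomial.aeval T₁ P D) = _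
    rw [aeval_apply_of_comm _ T₁ T₁ hcomm P D]
    change Polynomial.aeval T₁ P (complexBetti.map (θ₁ ≫ θ₂) (k + 2) D) = _
    rw [htop, map_smul]
  -- and it dies on `Y_t`
  refine eq_zero_of_topWeight_of_map_fiberι_eq_zero hg t (θ₁ ≫ θ₂) hνg hN hchart (by omega) htop' ?_
  obtain ⟨νt, A, e, hνt, he⟩ := hθ t
  obtain ⟨E, hEa, hEb⟩ := exists_fiberOver_familyPullback_iso f f t
  have hθ₁g : θ₁ ≫ (𝐛[f] ≫ f) = 𝐛[f] ≫ f := by rw [← Category.assoc, h1b]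
  obtain ⟨θ1t, hθ1t⟩ := exists_fiberEndo_restrict θ₁ hθ₁g t
  have c1 := squareEndo_fst_chart t ν h1a h1b E hEa hEb νt hνt θ1t hθ1t
  -- `J_t^* P(θ₁^*) = P(θ_{1,t}^*) J_t^*` and `E^* P(θ_{1,t}^*) = P((ν_t × 1)^*) E^*`
  have hJ : (𝐉[t, k + 2]).hom ∘ₗ T₁ = (complexBetti.map θ1t (k + 2)).hom ∘ₗ (𝐉[t, k + 2]).hom := by
    apply LinearMap.ext; intro w
    change 𝐉[t, k + 2] (complexBetti.map θ₁ (k + 2) w) = complexBetti.map θ1t (k + 2) (𝐉[t, k + 2] w)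
    rw [← complexBetti.map_comp_apply', ← complexBetti.map_comp_apply', hθ1t]
  have hE : (complexBetti.map E.hom (k + 2)).hom ∘ₗ (complexBetti.map θ1t (k + 2)).hom =
      (complexBetti.map (νt ▷ fiberOver f t) (k + 2)).hom ∘ₗ (complexBetti.map E.hom (k + 2)).hom := by
    apply LinearMap.ext; intro w
    change complexBetti.map E.hom (k + 2) (complexBetti.map θ1t (k + 2) w) =
      complexBetti.map (νt ▷ fiberOver f t) (k + 2) (complexBetti.map E.hom (k + 2) w)
    rw [← complexBetti.map_comp_apply', ← complexBetti.map_comp_apply', c1]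
  have h1 : complexBetti.map E.hom (k + 2) (𝐉[t, k + 2] (Polynomial.aeval T₁ P D)) = 0 := by
    change (complexBetti.map E.hom (k + 2)).hom ((𝐉[t, k + 2]).hom (Polynomial.aeval T₁ P D)) = 0
    rw [aeval_apply_of_comm _ T₁ _ hJ P D, aeval_apply_of_comm _ _ _ hE P]
    exact aeval_prod_whiskerRight_eq_zero (hf.isSmoothProjective_fiberOver t) νt N
      (fun u x ↦ map_fiberEndo_eq_smul_of_chart t νt A e N he u x) (k + 2) _
  -- `E^*` is injective
  have hinj : Function.Injective (complexBetti.map E.hom (k + 2)) := by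
    intro y y' hyy'
    have h := congrArg (complexBetti.map E.inv (k + 2)) hyy'
    rwa [← complexBetti.map_comp_apply', ← complexBetti.map_comp_apply', E.inv_hom_id, complexBetti.map_id,
      ModuleCat.id_apply, ModuleCat.id_apply] at h
  exact hinj (by rw [h1, map_zero])

include hf in
/-- **BI-WEIGHT DECOMPOSITION OF A TOP-WEIGHT CLASS OF THE SQUARE.** For `D ∈ H^{k+2}(𝒴)` with `(θ₁θ₂)^* D = N^{k+2} D` (`k ≤ 4d`) there
are classes `D_u`, `u ∈ {0, …, k+2}`, with `Σ_u D_u = D`, `θ₁^* D_u = Nᵘ D_u`, `(θ₁θ₂)^* D_u = N^{k+2} D_u`, and each `D_u = P_u(θ₁^*) D` for a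
polynomial `P_u` (the Lagrange interpolants at the distinct nodes `Nᵘ`; Mathlib `Lagrange.sum_basis`); consequently `D_u` is ALGEBRAIC whenever
`D` is (pull-backs preserve algebraic classes). Print: `H⁰(S, R^m(𝒴/S)) = ⊕_{u+v=m} H⁰(S, Rᵘ ⊗ Rᵛ)`. [cite: Kunnemann1993, §2]
[cite: DeningerMurre1991, Thm. 3.1] [cite: HatcherAT2002, §3.2 Thm. 3.15] -/
theorem exists_biweight_decomposition (t : ComplexPoints S) (ν : 𝒳 ⟶ 𝒳) (hν : ν ≫ f = f) {N : ℕ} (hN : 2 ≤ N)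
    (hθ : ∀ s : ComplexPoints S, ∃ (νs : fiberOver f s ⟶ fiberOver f s) (A : AbelianVariety ℂ) (e : A.X ≅ fiberOver f s),
      νs ≫ fiberι f s = fiberι f s ≫ ν ∧ e.hom ≫ νs = (N • 𝟙 A).hom.hom.hom ≫ e.hom)
    {θ₁ θ₂ : 𝒴[f] ⟶ 𝒴[f]} (h1a : θ₁ ≫ 𝐚[f] = 𝐚[f] ≫ ν) (h1b : θ₁ ≫ 𝐛[f] = 𝐛[f])
    (h2a : θ₂ ≫ 𝐚[f] = 𝐚[f]) (h2b : θ₂ ≫ 𝐛[f] = 𝐛[f] ≫ ν)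
    {k : ℕ} (hk : k ≤ 2 * (d + d)) {D : complexBetti 𝒴[f] (k + 2)}
    (htop : complexBetti.map (θ₁ ≫ θ₂) (k + 2) D = ((N : ℂ) ^ (k + 2)) • D) :
    ∃ Du : ℕ → complexBetti 𝒴[f] (k + 2),
      (∑ u ∈ Finset.range (k + 2 + 1), Du u = D) ∧
      (∀ u, complexBetti.map θ₁ (k + 2) (Du u) = ((N : ℂ) ^ u) • Du u) ∧
      (∀ u, complexBetti.map (θ₁ ≫ θ₂) (k + 2) (Du u) = ((N : ℂ) ^ (k + 2)) • Du u) ∧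
      (∀ u, ∃ P : Polynomial ℂ, Du u = Polynomial.aeval (complexBetti.map θ₁ (k + 2)).hom P D) := by
  classical
  set T₁ : Module.End ℂ (complexBetti 𝒴[f] (k + 2)) := (complexBetti.map θ₁ (k + 2)).hom with hT₁
  set s : Finset ℕ := Finset.range (k + 2 + 1) with hs
  set v : ℕ → ℂ := fun u ↦ (N : ℂ) ^ u with hv
  have hvs : Set.InjOn v s := fun u _ u' _ h ↦ by
    by_contra hne
    exact natCast_pow_ne_pow hN hne h
  -- polynomials in `θ₁^*` commute with `θ₁^*` and `(θ₁θ₂)^*`, and preserve algebraic classes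
  have hcomm : (complexBetti.map (θ₁ ≫ θ₂) (k + 2)).hom ∘ₗ T₁ = T₁ ∘ₗ (complexBetti.map (θ₁ ≫ θ₂) (k + 2)).hom := by
    apply LinearMap.ext; intro w
    change complexBetti.map (θ₁ ≫ θ₂) (k + 2) (complexBetti.map θ₁ (k + 2) w) =
      complexBetti.map θ₁ (k + 2) (complexBetti.map (θ₁ ≫ θ₂) (k + 2) w)
    rw [← complexBetti.map_comp_apply', ← complexBetti.map_comp_apply', Category.assoc,
      ← squareEndo_comm ν h1a h1b h2a h2b]
  refine ⟨fun u ↦ if u ∈ s then Polynomial.aeval T₁ (Lagrange.basis s v u) D else 0, ?_, fun u ↦ ?_, fun u ↦ ?_, fun u ↦ ?_⟩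
  · -- `Σ_u L_u(T) D = D`
    rw [Finset.sum_congr rfl fun u hu ↦ if_pos hu, ← LinearMap.sum_apply, ← map_sum, Lagrange.sum_basis hvs ⟨0, by simp [hs]⟩,
      map_one, Module.End.one_apply]
  · -- `(T − Nᵘ) L_u(T) D = c • ∏(T − N^{u'}) D = 0`
    by_cases hu : u ∈ s
    · simp only [if_pos hu]
      have key : (Polynomial.X - Polynomial.C (v u)) * Lagrange.basis s v u =
          Polynomial.C (Lagrange.nodalWeight s v u) * Lagrange.nodal s v := by
        rw [Lagrange.basis_eq_prod_sub_inv_mul_nodal_div hu, ← Lagrange.nodal_erase_eq_nodal_div hu, mul_left_comm,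
          ← Lagrange.nodal_eq_mul_nodal_erase hu]
      have h0 : Polynomial.aeval T₁ ((Polynomial.X - Polynomial.C (v u)) * Lagrange.basis s v u) D = 0 := by
        rw [key, map_mul, Module.End.mul_apply, Polynomial.aeval_C, Module.algebraMap_end_apply, Lagrange.nodal_eq,
          aeval_prod_squareEndo_fst_eq_zero_of_topWeight hf t ν hν hN hθ h1a h1b h2a h2b hk htop, smul_zero]
      rw [map_mul, Module.End.mul_apply, map_sub, Polynomial.aeval_X, Polynomial.aeval_C, LinearMap.sub_apply,
        Module.algebraMap_end_apply, sub_eq_zero] at h0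
      exact h0
    · simp only [if_neg hu, map_zero, smul_zero]
  · by_cases hu : u ∈ s
    · simp only [if_pos hu]
      change (complexBetti.map (θ₁ ≫ θ₂) (k + 2)).hom (Polynomial.aeval T₁ _ D) = _
      rw [aeval_apply_of_comm _ T₁ T₁ hcomm _ D]
      change Polynomial.aeval T₁ _ (complexBetti.map (θ₁ ≫ θ₂) (k + 2) D) = _
      rw [htop, map_smul]
    · simp only [if_neg hu, map_zero, smul_zero]
  · by_cases hu : u ∈ s
    · exact ⟨Lagrange.basis s v u, if_pos hu⟩
    · exact ⟨0, by simp only [if_neg hu, map_zero, LinearMap.zero_apply]⟩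

end Biweights

end Summit.HodgeConjecture.HodgeConjecture.Ring2.AbelianAll

end
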